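import Summits.QuantumFields.YangMills.Theorems.UnitScaleTiltHalvingSmallMembersCoverLiftStub
import Summits.QuantumFields.YangMills.Theorems.UnitScaleTiltHalvingSmallMembersCoverLiftStat
import Summits.QuantumFields.YangMills.Theorems.UnitScaleTiltHalvingSmallMembersCoverLiftTangentChart
import Summits.QuantumFields.YangMills.Theorems.UnitScaleTiltCoverDeckNaturality
import Summits.QuantumFields.YangMills.Theorems.UnitScaleTiltCoverDeckOrbitSum
import Summits.QuantumFields.YangMills.Theorems.UnitScaleTiltCoverDeckFibre
import HarnessLib

/-!
# H-SMALL (b7) LIFT PACKAGE, FILE 3b: ★★★ THE TANGENT ROW `htan` — `tangentLift`, AND THE CLOSED STATIONARITY LIFT `statLift`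

Route (b7) «COVER LIFT» (★★OWNER RULING №28 (2) ∕ №30 (4), LEAD-H L-7) for `stub_halvingStep` of stmt-QuantumFields-19200.  FILE 2b
(✓`SmallMembersCoverLiftStat.statLift_of_tangentLift`) reduced the stationarity lift `hlift` of FILE 2a (✓`SmallMembersCoverLiftStub.stub_of_roomHalvingStat`) to ONE
displayed tangent row `htan`; this file INHABITS it (`tangentLift`), records the closed lift (`statLift := statLift_of_tangentLift tangentLift`), and states the package as ONE implication
`stub_halvingStep_of_roomHalvingStat (H : ∀ L, RoomHalvingTextStat L) : <stub_halvingStep verbatim>`.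

THE ROW.  Member `U ∈ 𝔘_k(ε₀)` of run `K` over height `n < K` (`10¹⁰L⁶ε₀ ≤ 1`), cover family `F.cover jc`, lift `Ũ = U ∘ π`, and a curve `γ̃` of cover configurations through
`Ũ` inside the cover fibre `𝔅̃_k(V ∘ π)`, every bond variable differentiable at `0`; `ξ̃(b̃) := γ̃̇(b̃)·U(π b̃)^*` its right-trivialised velocity.  WANTED: a member curve
`Γ₀` through `U` with right-trivialised velocity `π_*ξ̃` (`CoverSites.pushBond`) whose GUARDED `(K−n)`-fold (0.4) average has zero bondwise derivative at `0`.

THE CONSTRUCTION.  `Γ₀(s)(b) := (∏_{b̃ ∈ π⁻¹b} γ̃(s)(b̃)·U(π b̃)^*)·U(b)` (ordered product in `SU(2)` over the fibre list): through `U` at `s = 0`, and its velocity is the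
SUM of the factors' velocities (FILE 3a `hasDerivAt_list_prod_one`) = `(π_*ξ̃)(b)·U(b)` — no Lie-algebra letter needed.

THE CONSTRAINT VELOCITY.  For a member `(K−n)`-bond `c = π c̃`: `Ū^{(K−n)}[Γ₀(s)](c) = Ū̃^{(K−n)}[Γ₀(s) ∘ π](c̃)` (FILE 1 `iter_blockAvg_comp_projBond`); the lifted
curve `Γ₀(s) ∘ π` is a cover curve through `Ũ ∈ 𝔘̃_k(ε₀)` with chart velocity `−i·(π_*ξ̃) ∘ π♭ = Σ_c −i·ξ̃ ∘ τ_c♭` (deck-orbit sum,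
✓`CoverDeckOrbitSum.sum_deck_bond_eq_pushBond_projBond`), so by FILE 3a `hasDerivAt_coe_iter_along_curve` its guarded average has derivative
`DΦ̃_c̃(0)[Σ_c −i·ξ̃∘τ_c♭]·C̃ = Σ_c DΦ̃_c̃(0)[−i·ξ̃∘τ_c♭]·C̃`, and EVERY summand vanishes by FILE 3a `fderiv_relIter_velocity_eq_zero` applied to the TRANSLATED curve
`γ̃(s) ∘ τ_c♭` — again a curve in the cover fibre through `Ũ` (deck-invariance of the cover fibre over a lifted datum,
✓`CoverDeckFibre.comp_deck_mem_fibre`; base point fixed by ✓`CoverDeckNaturality.comp_projBond_comp_deck`).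

HONEST SCOPE: calculus and covering-space bookkeeping; the analysis is ✓`Prop7SymAvgRelativeDiff.differentiableAt_relIter_of_plaqSmall` (through FILE 3a).  With this file the
(b7) package reads `stub_halvingStep ⟸ stub_of_roomHalvingStat statLift (door v3)`: ONE displayed input left, LEAD-H's `∀ L, RoomHalvingTextStat L`.  Rung R3 of the
ladder (YM₃ on T³ after Bałaban), not the Clay problem; no crux or stub is claimed closed here.

References: T. Bałaban, CMP **102** (1985) 277–309 [Balaban1985Variational] ((2)–(6) p.278, (26)–(27) p.282, (127) p.297, (141)–(144) pp.299–300, (152) p.301);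
CMP **109** (1987) 249–301 [Balaban1987RG1] ((0.1)–(0.4) pp.251–253, (0.11) p.253).
-/

set_option autoImplicit false

noncomputable section

open scoped BigOperators Matrix.Norms.L2Operator Matrix Topology

namespace Summit.QuantumFields.YangMills.Theorems.SmallMembersCoverLiftTangent

open Literature.MathematicalPhysics.QuantumFieldTheory.Balaban1983to89
open T4Continuum AveragingRT BlockAveraging ExpMeanLog
open T3ContinuumYM3Torus (T3Family)
open T3Thm1Carrier (famX Idx)
open T3Thm1CarrierNative (IsCritR2)
open T3PrintedRegularMinimiser (RegPr)
open T3ConstrainedMinimiser (fibre)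
open T3UnitLawDensityEML (ℰp)
open B10Eq27TorusAxialLog (unitsField toUField)
open CoverSites (cover proj projBond pushBond projBond_surjective)
open Summit.QuantumFields.YangMills.Theorems.Prop8Chart (expCfg emlIterU)
open Summit.QuantumFields.YangMills.Theorems.WilsonActionFirstVariation (hasDerivAt_mul_star_of_differentiableAt)
open Summit.QuantumFields.YangMills.Theorems.SmallMembersCoverLift (iter_blockAvg_comp_projBond regPr_cover_iff)
open Summit.QuantumFields.YangMills.Theorems.SmallMembersCoverLiftTangentChart (hasDerivAt_list_prod_one hasDerivAt_coe_iter_along_curve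
  fderiv_relIter_velocity_eq_zero)
open Summit.QuantumFields.YangMills.Theorems.CoverDeckNaturality (comp_projBond_comp_deck)
open Summit.QuantumFields.YangMills.Theorems.CoverDeckFibre (comp_deck_mem_fibre)

/-! ## ★★★ The tangent row -/

section Tangent

open Summit.QuantumFields.YangMills.Theorems.CoverDeckOrbitSum (sum_deck_bond_eq_pushBond_projBond)

/-- ★★★ **THE TANGENT ROW `htan` OF THE (b7) COVER LIFT** (FILE 2b's displayed binder, VERBATIM).  For a member `U ∈ 𝔘_k(ε₀)` (`10¹⁰L⁶ε₀ ≤ 1`) and a bondwise-differentiable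
curve `γ̃` in the cover fibre `𝔅̃_k(V ∘ π)` through the lift `U ∘ π`, the member curve `Γ₀(s)(b) := (∏_{b̃ ∈ π⁻¹b} γ̃(s)(b̃)·U(π b̃)^*)·U(b)` passes through `U`, has
right-trivialised velocity `π_*ξ̃` (`ξ̃(b̃) = γ̃̇(b̃)U(π b̃)^*`; velocities add along the ordered product, FILE 3a §1), and its guarded `(K−n)`-fold (0.4) average has
zero derivative at `s = 0` in every bond: read on the cover at a lift `c̃` of the bond (FILE 1 `iter_blockAvg_comp_projBond`), the derivative is
`DΦ̃_c̃(0)[−i·(π_*ξ̃)∘π♭]·C̃` (FILE 3a `hasDerivAt_coe_iter_along_curve` on `F.cover jc`), `(π_*ξ̃)∘π♭ = Σ_c ξ̃∘τ_c♭` (✓`sum_deck_bond_eq_pushBond_projBond`), and each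
`DΦ̃_c̃(0)[−i·ξ̃∘τ_c♭] = 0` by FILE 3a `fderiv_relIter_velocity_eq_zero` for the translated fibre curve `γ̃(s)∘τ_c♭` (✓`CoverDeckFibre.comp_deck_mem_fibre`).  The R2-criticality hypothesis is not
used by this row. [cite: Balaban1985Variational, (2)-(3) p.278, (127) p.297, (144) p.300, (152) p.301; Balaban1987RG1, (0.1) p.251, (0.11) p.253] -/
theorem tangentLift : ∀ (F : T3Family) (jc n K : ℕ) (hnK : n < K) (ε₀ : ℝ)
      (V : GaugeField (F.P n) 0 (Matrix.specialUnitaryGroup (Fin 2) ℂ)) (U : GaugeField (F.P K) 0 (Matrix.specialUnitaryGroup (Fin 2) ℂ)),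
      0 < ε₀ → 10 ^ 10 * (F.L : ℝ) ^ 6 * ε₀ ≤ 1 → RegPr F n K ε₀ U → IsCritR2 F n K hnK.le V U →
      ∀ γ : ℝ → GaugeField ((F.cover jc).P K) 0 (Matrix.specialUnitaryGroup (Fin 2) ℂ), γ 0 = U ∘ projBond (F.P K) jc 0 →
        (∀ t, γ t ∈ fibre (F.cover jc) ℰp n K hnK.le (V ∘ projBond (F.P n) jc 0)) →
        (∀ b, DifferentiableAt ℝ (fun t => ((γ t b : Matrix.specialUnitaryGroup (Fin 2) ℂ) : Matrix (Fin 2) (Fin 2) ℂ)) 0) →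
        ∃ Γ₀ : ℝ → GaugeField (F.P K) 0 (Matrix.specialUnitaryGroup (Fin 2) ℂ), Γ₀ 0 = U ∧
          (∀ b : PBond (F.P K) 0, HasDerivAt (fun s : ℝ => ((Γ₀ s b : Matrix.specialUnitaryGroup (Fin 2) ℂ) : Matrix (Fin 2) (Fin 2) ℂ))
            (pushBond (F.P K) jc 0 (fun bt : PBond ((F.cover jc).P K) 0 =>
                deriv (fun t : ℝ => ((γ t bt : Matrix.specialUnitaryGroup (Fin 2) ℂ) : Matrix (Fin 2) (Fin 2) ℂ)) 0 *
                  star ((U (projBond (F.P K) jc 0 bt) : Matrix.specialUnitaryGroup (Fin 2) ℂ) : Matrix (Fin 2) (Fin 2) ℂ)) b *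
              ((U b : Matrix.specialUnitaryGroup (Fin 2) ℂ) : Matrix (Fin 2) (Fin 2) ℂ)) 0) ∧
          ∀ c : PBond (F.P K) (K - n),
            deriv (fun s : ℝ => ((Averaging.iter (fun i => blockAvg (P := F.P K) (j := i) (expMeanLogSU (n := Fin 2))) (K - n) (Γ₀ s) c :
              Matrix.specialUnitaryGroup (Fin 2) ℂ) : Matrix (Fin 2) (Fin 2) ℂ)) 0 = 0 := by
  intro F jc n K hnK ε₀ V U hε₀ hε hreg _hcrit γ hγ0 hγfib hγd
  -- the right-trivialised velocity field of `γ̃`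
  set ξt : PBond ((F.cover jc).P K) 0 → Matrix (Fin 2) (Fin 2) ℂ := fun bt =>
    deriv (fun t : ℝ => ((γ t bt : Matrix.specialUnitaryGroup (Fin 2) ℂ) : Matrix (Fin 2) (Fin 2) ℂ)) 0 *
      star ((U (projBond (F.P K) jc 0 bt) : Matrix.specialUnitaryGroup (Fin 2) ℂ) : Matrix (Fin 2) (Fin 2) ℂ) with hξt
  -- the factors of the product curve, read in `M₂(ℂ)`: curves through `1` with velocities `ξ̃(b̃)`
  set cf : PBond ((F.cover jc).P K) 0 → ℝ → Matrix (Fin 2) (Fin 2) ℂ := fun bt s =>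
    ((γ s bt : Matrix.specialUnitaryGroup (Fin 2) ℂ) : Matrix (Fin 2) (Fin 2) ℂ) *
      star ((U (projBond (F.P K) jc 0 bt) : Matrix.specialUnitaryGroup (Fin 2) ℂ) : Matrix (Fin 2) (Fin 2) ℂ) with hcf
  have hUU : ∀ b : PBond (F.P K) 0, ((U b : Matrix.specialUnitaryGroup (Fin 2) ℂ) : Matrix (Fin 2) (Fin 2) ℂ) *
      star ((U b : Matrix.specialUnitaryGroup (Fin 2) ℂ) : Matrix (Fin 2) (Fin 2) ℂ) = 1 :=
    fun b => Matrix.mem_unitaryGroup_iff.mp (U b).2.1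
  have hUU' : ∀ b : PBond (F.P K) 0, star ((U b : Matrix.specialUnitaryGroup (Fin 2) ℂ) : Matrix (Fin 2) (Fin 2) ℂ) *
      ((U b : Matrix.specialUnitaryGroup (Fin 2) ℂ) : Matrix (Fin 2) (Fin 2) ℂ) = 1 :=
    fun b => Matrix.mem_unitaryGroup_iff'.mp (U b).2.1
  have hcf0 : ∀ bt, cf bt 0 = 1 := fun bt => by
    rw [hcf]; dsimp only; rw [hγ0]; exact hUU (projBond (F.P K) jc 0 bt)
  have hcfd : ∀ bt, HasDerivAt (cf bt) (ξt bt) 0 := fun bt =>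
    hasDerivAt_mul_star_of_differentiableAt γ (U ∘ projBond (F.P K) jc 0) bt (hγd bt)
  -- the fibre list over a member bond and the product curve
  set lb : PBond (F.P K) 0 → List (PBond ((F.cover jc).P K) 0) := fun b =>
    (Finset.univ.filter (fun bt : PBond ((F.cover jc).P K) 0 => projBond (F.P K) jc 0 bt = b)).toList with hlb
  set Γ₀ : ℝ → GaugeField (F.P K) 0 (Matrix.specialUnitaryGroup (Fin 2) ℂ) := fun s b =>
    ((lb b).map fun bt => γ s bt * star (U (projBond (F.P K) jc 0 bt))).prod * U b with hΓ₀
  have hΓ₀coe : ∀ (s : ℝ) (b : PBond (F.P K) 0), ((Γ₀ s b : Matrix.specialUnitaryGroup (Fin 2) ℂ) : Matrix (Fin 2) (Fin 2) ℂ) =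
      ((lb b).map fun bt => cf bt s).prod * ((U b : Matrix.specialUnitaryGroup (Fin 2) ℂ) : Matrix (Fin 2) (Fin 2) ℂ) := by
    intro s b
    rw [hΓ₀, hcf]; dsimp only
    rw [Submonoid.coe_mul, Submonoid.coe_list_prod, List.map_map]
    rfl
  -- clause 1: through `U`
  have hΓ₀0 : Γ₀ 0 = U := by
    funext b
    rw [hΓ₀]; dsimp only
    rw [List.prod_eq_one, one_mul]
    intro x hx
    obtain ⟨bt, _, rfl⟩ := List.mem_map.1 hx
    rw [hγ0, Function.comp_apply, Matrix.star_eq_inv, mul_inv_cancel]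
  -- clause 2: the velocity `π_* ξ̃`
  have hΓ₀d : ∀ b : PBond (F.P K) 0, HasDerivAt (fun s : ℝ => ((Γ₀ s b : Matrix.specialUnitaryGroup (Fin 2) ℂ) : Matrix (Fin 2) (Fin 2) ℂ))
      (pushBond (F.P K) jc 0 ξt b * ((U b : Matrix.specialUnitaryGroup (Fin 2) ℂ) : Matrix (Fin 2) (Fin 2) ℂ)) 0 := by
    intro b
    have hsum : ((lb b).map ξt).sum = pushBond (F.P K) jc 0 ξt b := by
      rw [hlb]; dsimp only
      rw [Finset.sum_map_toList, CoverSites.pushBond_apply]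
      congr
    have h := (hasDerivAt_list_prod_one cf ξt hcf0 hcfd (lb b)).mul_const ((U b : Matrix.specialUnitaryGroup (Fin 2) ℂ) : Matrix (Fin 2) (Fin 2) ℂ)
    rw [hsum] at h
    refine h.congr_of_eventuallyEq (Filter.Eventually.of_forall fun s => ?_)
    exact hΓ₀coe s b
  refine ⟨Γ₀, hΓ₀0, hΓ₀d, fun c => ?_⟩
  -- clause 3: the constraint velocity, read on the cover at a lift `c̃` of `c`
  obtain ⟨ct, rfl⟩ := projBond_surjective (F.P K) jc (K - n) c
  have hk : K - n ≤ (F.P K).m + (F.P K).K := by show K - n ≤ F.m + K; omega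
  set Γt : ℝ → GaugeField ((F.cover jc).P K) 0 (Matrix.specialUnitaryGroup (Fin 2) ℂ) := fun s => Γ₀ s ∘ projBond (F.P K) jc 0 with hΓt
  -- (A) member average at `π c̃` = cover average of the lifted curve at `c̃`
  have hA : (fun s : ℝ => ((Averaging.iter (fun i => blockAvg (P := F.P K) (j := i) (expMeanLogSU (n := Fin 2))) (K - n) (Γ₀ s)
        (projBond (F.P K) jc (K - n) ct) : Matrix.specialUnitaryGroup (Fin 2) ℂ) : Matrix (Fin 2) (Fin 2) ℂ)) =
      fun s : ℝ => ((Averaging.iter (fun i => blockAvg (P := (F.cover jc).P K) (j := i) ℰp) (K - n) (Γt s) ct :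
        Matrix.specialUnitaryGroup (Fin 2) ℂ) : Matrix (Fin 2) (Fin 2) ℂ) := by
    funext s
    have h := congrFun (iter_blockAvg_comp_projBond (F.P K) jc ℰp (Γ₀ s) (K - n) hk) ct
    exact congrArg (fun g : Matrix.specialUnitaryGroup (Fin 2) ℂ => (g : Matrix (Fin 2) (Fin 2) ℂ)) h.symm
  -- (B) the lifted curve `Γ₀(s) ∘ π` is a cover curve through `Ũ ∈ 𝔘̃_k(ε₀)`, bondwise differentiable: its guarded average has a derivative read in the chart
  have hUt : RegPr (F.cover jc) n K ε₀ (U ∘ projBond (F.P K) jc 0) := (regPr_cover_iff jc F ε₀ U).2 hreg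
  have hεt : 10 ^ 10 * ((F.cover jc).L : ℝ) ^ 6 * ε₀ ≤ 1 := hε
  have hΓt0 : Γt 0 = U ∘ projBond (F.P K) jc 0 := by
    funext bt
    show Γ₀ 0 (projBond (F.P K) jc 0 bt) = U (projBond (F.P K) jc 0 bt)
    rw [hΓ₀0]
  have hΓtd : ∀ bt : PBond ((F.cover jc).P K) 0,
      DifferentiableAt ℝ (fun s : ℝ => ((Γt s bt : Matrix.specialUnitaryGroup (Fin 2) ℂ) : Matrix (Fin 2) (Fin 2) ℂ)) 0 :=
    fun bt => (hΓ₀d (projBond (F.P K) jc 0 bt)).differentiableAt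
  have hB := hasDerivAt_coe_iter_along_curve (F.cover jc) (n := n) (K := K) hε₀ hεt (U ∘ projBond (F.P K) jc 0) hUt Γt hΓt0 hΓtd ct
  -- (C) the chart velocity of the lifted curve is the deck-orbit sum of the translated velocities of `γ̃`
  set τ : (Fin (F.P K).d → Fin ((F.P K).L ^ jc)) → PBond (cover (F.P K) jc) 0 → PBond (cover (F.P K) jc) 0 := fun cd bt =>
    ⟨fun ν => bt.src ν + (((cd ν : ℕ) * (F.P K).sitesPerDir 0 : ℕ) : ZMod ((cover (F.P K) jc).sitesPerDir 0)), bt.dir⟩ with hτ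
  have hUτ : ∀ cd bt, U (projBond (F.P K) jc 0 (τ cd bt)) = U (projBond (F.P K) jc 0 bt) := fun cd bt =>
    congrFun (comp_projBond_comp_deck (F.P K) jc (fun ν => (cd ν : ℕ)) U) bt
  have hγτ0 : ∀ cd, (fun s : ℝ => γ s ∘ τ cd) 0 = U ∘ projBond (F.P K) jc 0 := fun cd => by
    dsimp only; rw [hγ0]; exact comp_projBond_comp_deck (F.P K) jc (fun ν => (cd ν : ℕ)) U
  have hv : (fun b : PBond ((F.cover jc).P K) 0 => (-Complex.I) •
        (deriv (fun t : ℝ => ((Γt t b : Matrix.specialUnitaryGroup (Fin 2) ℂ) : Matrix (Fin 2) (Fin 2) ℂ)) 0 *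
          star ((((U ∘ projBond (F.P K) jc 0) b : Matrix.specialUnitaryGroup (Fin 2) ℂ) : Matrix (Fin 2) (Fin 2) ℂ)))) =
      ∑ cd : Fin (F.P K).d → Fin ((F.P K).L ^ jc), fun b : PBond ((F.cover jc).P K) 0 => (-Complex.I) •
        (deriv (fun t : ℝ => (((γ t ∘ τ cd) b : Matrix.specialUnitaryGroup (Fin 2) ℂ) : Matrix (Fin 2) (Fin 2) ℂ)) 0 *
          star ((((U ∘ projBond (F.P K) jc 0) b : Matrix.specialUnitaryGroup (Fin 2) ℂ) : Matrix (Fin 2) (Fin 2) ℂ))) := by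
    funext b
    rw [Finset.sum_apply]
    have hd : deriv (fun t : ℝ => ((Γt t b : Matrix.specialUnitaryGroup (Fin 2) ℂ) : Matrix (Fin 2) (Fin 2) ℂ)) 0 =
        pushBond (F.P K) jc 0 ξt (projBond (F.P K) jc 0 b) *
          ((U (projBond (F.P K) jc 0 b) : Matrix.specialUnitaryGroup (Fin 2) ℂ) : Matrix (Fin 2) (Fin 2) ℂ) :=
      (hΓ₀d (projBond (F.P K) jc 0 b)).deriv
    rw [hd, Function.comp_apply, mul_assoc, hUU, mul_one,
      ← sum_deck_bond_eq_pushBond_projBond (F.P K) jc (i := 0) (Nat.zero_le _) ξt b, Finset.smul_sum]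
    refine Finset.sum_congr rfl fun cd _ => ?_
    show -Complex.I • (deriv (fun t : ℝ => ((γ t (τ cd b) : Matrix.specialUnitaryGroup (Fin 2) ℂ) : Matrix (Fin 2) (Fin 2) ℂ)) 0 *
          star ((U (projBond (F.P K) jc 0 (τ cd b)) : Matrix (Fin 2) (Fin 2) ℂ))) =
      -Complex.I • (deriv (fun t : ℝ => ((γ t (τ cd b) : Matrix.specialUnitaryGroup (Fin 2) ℂ) : Matrix (Fin 2) (Fin 2) ℂ)) 0 *
          star ((U (projBond (F.P K) jc 0 b)) : Matrix (Fin 2) (Fin 2) ℂ))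
    rw [hUτ cd b]
  -- (D) every translated velocity is killed: `γ̃ ∘ τ_c♭` is again a fibre curve through `Ũ`
  have hD : ∀ cd : Fin (F.P K).d → Fin ((F.P K).L ^ jc),
      (fderiv ℂ (fun A : PBond ((F.cover jc).P K) 0 → Matrix (Fin 2) (Fin 2) ℂ =>
          ((emlIterU (K - n) (fun b => expCfg 1 A b * unitsField (toUField (U ∘ projBond (F.P K) jc 0)) b) ct :
              (Matrix (Fin 2) (Fin 2) ℂ)ˣ) : Matrix (Fin 2) (Fin 2) ℂ) *
            (((emlIterU (K - n) (unitsField (toUField (U ∘ projBond (F.P K) jc 0))) ct)⁻¹ : (Matrix (Fin 2) (Fin 2) ℂ)ˣ) :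
              Matrix (Fin 2) (Fin 2) ℂ)) 0)
        (fun b : PBond ((F.cover jc).P K) 0 => (-Complex.I) •
          (deriv (fun t : ℝ => (((γ t ∘ τ cd) b : Matrix.specialUnitaryGroup (Fin 2) ℂ) : Matrix (Fin 2) (Fin 2) ℂ)) 0 *
            star ((((U ∘ projBond (F.P K) jc 0) b : Matrix.specialUnitaryGroup (Fin 2) ℂ) : Matrix (Fin 2) (Fin 2) ℂ)))) = 0 :=
    fun cd => fderiv_relIter_velocity_eq_zero (F.cover jc) hnK.le hε₀ hεt (V ∘ projBond (F.P n) jc 0) (U ∘ projBond (F.P K) jc 0) hUt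
      (fun s => γ s ∘ τ cd) (hγτ0 cd) (fun s => comp_deck_mem_fibre F jc (fun ν => (cd ν : ℕ)) ℰp hnK.le V (hγfib s))
      (fun b => hγd (τ cd b)) ct
  -- (E) the derivative of the cover average is `(Σ_c 0)·C̃ = 0`; transport to the member bond `π c̃`
  have key : ∀ v : PBond ((F.cover jc).P K) 0 → Matrix (Fin 2) (Fin 2) ℂ,
      v = ∑ cd : Fin (F.P K).d → Fin ((F.P K).L ^ jc), (fun b : PBond ((F.cover jc).P K) 0 => (-Complex.I) •
        (deriv (fun t : ℝ => (((γ t ∘ τ cd) b : Matrix.specialUnitaryGroup (Fin 2) ℂ) : Matrix (Fin 2) (Fin 2) ℂ)) 0 *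
          star ((((U ∘ projBond (F.P K) jc 0) b : Matrix.specialUnitaryGroup (Fin 2) ℂ) : Matrix (Fin 2) (Fin 2) ℂ)))) →
      HasDerivAt (fun s : ℝ => ((Averaging.iter (fun i => blockAvg (P := (F.cover jc).P K) (j := i) ℰp) (K - n) (Γt s) ct :
          Matrix.specialUnitaryGroup (Fin 2) ℂ) : Matrix (Fin 2) (Fin 2) ℂ))
        ((fderiv ℂ (fun A : PBond ((F.cover jc).P K) 0 → Matrix (Fin 2) (Fin 2) ℂ =>
            ((emlIterU (K - n) (fun b => expCfg 1 A b * unitsField (toUField (U ∘ projBond (F.P K) jc 0)) b) ct :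
                (Matrix (Fin 2) (Fin 2) ℂ)ˣ) : Matrix (Fin 2) (Fin 2) ℂ) *
              (((emlIterU (K - n) (unitsField (toUField (U ∘ projBond (F.P K) jc 0))) ct)⁻¹ : (Matrix (Fin 2) (Fin 2) ℂ)ˣ) :
                Matrix (Fin 2) (Fin 2) ℂ)) 0) v *
          ((emlIterU (K - n) (unitsField (toUField (U ∘ projBond (F.P K) jc 0))) ct : (Matrix (Fin 2) (Fin 2) ℂ)ˣ) :
            Matrix (Fin 2) (Fin 2) ℂ)) 0 →
      HasDerivAt (fun s : ℝ => ((Averaging.iter (fun i => blockAvg (P := (F.cover jc).P K) (j := i) ℰp) (K - n) (Γt s) ct :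
          Matrix.specialUnitaryGroup (Fin 2) ℂ) : Matrix (Fin 2) (Fin 2) ℂ)) (0 : Matrix (Fin 2) (Fin 2) ℂ) 0 := by
    intro v hv' hB'
    subst hv'
    rw [map_sum, Finset.sum_eq_zero (fun cd _ => hD cd), zero_mul] at hB'
    exact hB'
  rw [hA]
  exact (key _ hv hB).deriv


/-- ★★★ **THE STATIONARITY LIFT `hlift` OF FILE 2a, CLOSED**: FILE 2b's ✓`statLift_of_tangentLift` applied to `tangentLift` — for `L > 1` there is `aS(L) = (10¹⁰L⁶)⁻¹ > 0`
such that for every member `U ∈ 𝔘_k(ε₀)`, `ε₀ ≤ aS`, R2-critical over `V`, and every bondwise-differentiable curve `γ̃` in the cover fibre `𝔅̃_k(V ∘ π)` through `U ∘ π`,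
`d/dt A(γ̃(t))|₀ = 0`.  With this the (b7) package reads `stub_halvingStep ⟸ SmallMembersCoverLiftStub.stub_of_roomHalvingStat statLift H`, `H = ∀ L, RoomHalvingTextStat L`
(LEAD-H's door v3). [cite: Balaban1985Variational, Thm 1 p.279, (2)-(8) pp.278-279, (127) p.297, (141)-(144) pp.299-300] -/
theorem statLift :
    ∀ L : ℕ, 1 < L → ∃ aS : ℝ, 0 < aS ∧ ∀ (F : T3Family), F.L = L → ∀ (jc n K : ℕ) (hnK : n < K) (ε₀ : ℝ)
      (V : GaugeField (F.P n) 0 (Matrix.specialUnitaryGroup (Fin 2) ℂ)) (U : GaugeField (F.P K) 0 (Matrix.specialUnitaryGroup (Fin 2) ℂ)),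
      0 < ε₀ → ε₀ ≤ aS → RegPr F n K ε₀ U → IsCritR2 F n K hnK.le V U →
      ∀ γ : ℝ → GaugeField ((F.cover jc).P K) 0 (Matrix.specialUnitaryGroup (Fin 2) ℂ), γ 0 = U ∘ projBond (F.P K) jc 0 →
        (∀ t, γ t ∈ fibre (F.cover jc) ℰp n K hnK.le (V ∘ projBond (F.P n) jc 0)) →
        (∀ b, DifferentiableAt ℝ (fun t => ((γ t b : Matrix.specialUnitaryGroup (Fin 2) ℂ) : Matrix (Fin 2) (Fin 2) ℂ)) 0) →
        deriv (fun t => wilsonAction4 (γ t)) 0 = 0 :=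
  SmallMembersCoverLiftStat.statLift_of_tangentLift tangentLift


/-- ★★★ **THE (b7) COVER-LIFT PACKAGE IN ONE IMPLICATION: THE REGISTERED STUB `stub_halvingStep` FROM LEAD-H's FIRST-ORDER ROOM DOOR ALONE.**
`stub_of_roomHalvingStat statLift H` — FILE 2a's reduction with its stationarity input discharged by `statLift`; the hypothesis `H : ∀ L, RoomHalvingTextStat L` is
LEAD-H RULING L-7 (a) verbatim (door v3, ★w3-19200's `…HalvingStepOfPillarsRoomStat*` chain), the conclusion is the text of `stub_halvingStep` of
`Cruxes/MinimiserStabilityRegPr/Lines/birth_v10.lean` verbatim.  No stub or crux is claimed closed: `H` is displayed. [cite: Balaban1985Variational, Thm 1 p.279, (2)-(8) pp.278-279, Prop. 8 p.304, (144) p.300] -/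
theorem stub_halvingStep_of_roomHalvingStat
    (H : ∀ L : ℕ, 1 < L → ∃ B₃ : ℝ, 4 < B₃ ∧ ∃ a₅ : ℝ, 0 < a₅ ∧ ∃ N : ℕ, ∀ (i : Idx L), N ≤ (i.1.1).L ^ ((i.1.1).m + i.1.2.1) →
      ∀ (ε₀ ε₁ : ℝ), 0 < ε₁ → ∀ (V : (famX L i).Bdry) (U : (famX L i).Cfg), (famX L i).Reg7 ε₁ V → (famX L i).InU ε₀ U → (famX L i).InB V U →
      (∀ γ : ℝ → GaugeField ((i.1.1).P i.1.2.2) 0 (Matrix.specialUnitaryGroup (Fin 2) ℂ), γ 0 = U →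
        (∀ t, γ t ∈ fibre i.1.1 ℰp i.1.2.1 i.1.2.2 i.2.2.le V) →
        (∀ b, DifferentiableAt ℝ (fun t => ((γ t b : Matrix.specialUnitaryGroup (Fin 2) ℂ) : Matrix (Fin 2) (Fin 2) ℂ)) 0) →
        deriv (fun t => wilsonAction4 (γ t)) 0 = 0) →
      ε₀ ≤ a₅ → (famX L i).InU (max (B₃ * ε₁) (ε₀ / 2)) U) :
    ∀ (L : ℕ), 1 < L → ∃ B₃ : ℝ, 4 < B₃ ∧ ∃ a₅ : ℝ, 0 < a₅ ∧
      ∀ (i : Idx L) (ε₀ ε₁ : ℝ), 0 < ε₁ → ∀ (V : (famX L i).Bdry) (U : (famX L i).Cfg), (famX L i).Reg7 ε₁ V → (famX L i).InU ε₀ U →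
        (famX L i).InB V U → (famX L i).IsCritical V U → ε₀ ≤ a₅ → (famX L i).InU (max (B₃ * ε₁) (ε₀ / 2)) U :=
  SmallMembersCoverLiftStub.stub_of_roomHalvingStat statLift H

end Tangent

end Summit.QuantumFields.YangMills.Theorems.SmallMembersCoverLiftTangent
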